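import Summits.KontsevichZagierPeriods.KontsevichZagierPeriods.Theorems.HyperbolicBlochOffTetraSectorKernelStubInvert
import Summits.KontsevichZagierPeriods.KontsevichZagierPeriods.Theorems.HyperbolicBlochOffTetraSectorKernelStubDescend
import Summits.KontsevichZagierPeriods.KontsevichZagierPeriods.Theorems.HyperbolicBlochOffTetraSectorKernelStubFanCell
import Summits.KontsevichZagierPeriods.KontsevichZagierPeriods.Theorems.HyperbolicBlochOffTetraSectorKernelStubVCell
import Summits.KontsevichZagierPeriods.KontsevichZagierPeriods.Theorems.HyperbolicBlochOffTetraSectorKernelStubRayScale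
import Summits.KontsevichZagierPeriods.KontsevichZagierPeriods.Theorems.HyperbolicBlochOffTetraSectorKernelStubCellAlgebra
import Summits.KontsevichZagierPeriods.KontsevichZagierPeriods.Theorems.HyperbolicBlochOffTetraSectorKernelStubCellScale
import Summits.KontsevichZagierPeriods.KontsevichZagierPeriods.Theorems.HyperbolicBlochOffTetraSectorKernelStubMobiusCell

/-!
# `OffTetraSectorKernel` (stmt-KontsevichZagierPeriods-10557), line `flat-shadow`: the Milnor bridge

**Milnor's identity `vol T(z) = D(z)` holds INSIDE Kontsevich–Zagier's rules.** For every `z` algebraic over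
`ℚ` with `Im z > 0`, the hyperbolic representation `[T(∞,0,1,z), t⁻³]` of the ideal tetrahedron
(`KZ.idealTetrahedronRep z`, dimension 3, the oracle generator of the crux `OffTetraSectorKernel` of route
HyperbolicBloch) is KZ-EQUIVALENT — joined by finitely many instances of rules (1), (2), (3) — to Zagier's planar
ray representation `KZ.rayDilogRep z.re z.im` of the Bloch–Wigner dilogarithm `D(z)` (the currency of route
K2SymbolChains; the identification that `KZRayDilog.lean` left "not claimed"). The eight stations are the landed
stubs of the line (Stage 1: `stub_invert`, `stub_descend` — cusp descent `t ↦ 1/t` and Newton–Leibniz with the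
polynomial primitive `s²/2`; Stage 2: `stub_fanCell`, `stub_vCell`, `stub_rayScale`, `stub_cellAlgebra`,
`stub_cellScale`, `stub_mobiusCell` — the fan map, the `v`-substitution, the log-cell algebra, two scalings and
the Möbius involution, i.e. Parts V/M of the tree's analytic proof `BlochWigner_idealTetrahedronVolume_holds`
re-read as moves between planar representations). This file only composes them:

* `tetraFlatten` — `[T(z), t⁻³] ∼ [Δ(0,1,z), b/(2 pw)]` (the flat shadow);
* `rayMeetsShadow` — `[Δ(0,1,z), b/(2 pw)] ∼` any representation on Zagier's ray domain with Zagier's integrand;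
* `milnorBridge` — `KZ.Equivalent (KZ.idealTetrahedronRep z hz him) (KZ.rayDilogRep z.re z.im _ _)`;
* `exists_flatRep`, `exists_flatFamily`, `exists_rayFamily` — non-vacuity of the pinned-family idioms.

As a corollary (`value_idealTetrahedronRep_eq_rayDilog`) the VALUE identity `∫_{T(z)} t⁻³ = rayDilog z.re z.im`
drops out of the soundness of the calculus — an independent route to the tree's analytic theorem.

References: J. Milnor, *Hyperbolic geometry: the first 150 years* (1982), Appendix, Lemma 2; D. Zagier, *The
dilogarithm function* (2007), Ch. I §3; J. L. Dupont, *Scissors congruences, group homology and characteristic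
classes* (2001), Ch. 10, (10.9); M. Kontsevich, D. Zagier, *Periods* (2001), §1.2.
-/

noncomputable section

open Set MeasureTheory
open Literature.NumberTheory.Transcendental

namespace Summit.KontsevichZagierPeriods.HyperbolicBloch.OffTetraSectorKernel

/-- **Flattening** (`stub_invert` then `stub_descend`): for algebraic `z` with `Im z > 0`, every representation
`[T(z), t⁻³]` is KZ-equivalent to every flat-shadow representation `[Δ(z), Im z/(2 pw_z)]`,
`pw_z(q) = Im z (q₀ − q₀² − q₁²) + (|z|² − Re z) q₁`. [cite: Milnor1982, Appendix, Lemma 2] -/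
theorem tetraFlatten (z : ℂ) (hz : IsAlgebraic ℚ z) (him : 0 < z.im) (r : KZ.IntegralRep 3)
    (s : KZ.IntegralRep 2) (hr : r.domain = idealTetrahedron z)
    (hri : EqOn r.integrand (fun p => 1 / p 2 ^ 3) r.domain)
    (hs : s.domain = {q | 0 < q 1 ∧ z.re * q 1 < z.im * q 0 ∧ z.im * (q 0 - 1) < (z.re - 1) * q 1})
    (hsi : EqOn s.integrand
      (fun q => z.im / (2 * (z.im * (q 0 - q 0 ^ 2 - q 1 ^ 2) + (Complex.normSq z - z.re) * q 1)))
      s.domain) :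
    KZ.Equivalent r s := by
  obtain ⟨⟨m, hm, hmi⟩, hall⟩ := stub_invert _ (fun _ => rfl) z hz him r hr hri
  have h2 := (stub_descend _ (fun _ => rfl) _ (fun _ => rfl) _ (fun _ _ => rfl) z hz him m hm hmi).2
    s hs hsi
  exact (hall m hm hmi).trans h2

/-- **The Milnor bridge, planar half** (`RayMeetsShadow`): for algebraic `z` with `Im z > 0`, every flat-shadow
representation is KZ-equivalent to every representation on Zagier's ray domain with Zagier's ray integrand — fan
cell, `v`-cell, log-cell algebra, scaling and the Möbius cell. [cite: Zagier2007Dilogarithm, Ch. I §3] -/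
theorem rayMeetsShadow : ∀ z : ℂ, IsAlgebraic ℚ z → 0 < z.im → ∀ s r : Literature.NumberTheory.Transcendental.KZ.IntegralRep 2, s.domain = {q | 0 < q 1 ∧ z.re * q 1 < z.im * q 0 ∧ z.im * (q 0 - 1) < (z.re - 1) * q 1} → Set.EqOn s.integrand (fun q => z.im / (2 * (z.im * (q 0 - q 0 ^ 2 - q 1 ^ 2) + (Complex.normSq z - z.re) * q 1))) s.domain → r.domain = Literature.NumberTheory.Transcendental.KZ.rayDilogDomain z.re z.im → Set.EqOn r.integrand (Literature.NumberTheory.Transcendental.KZ.rayDilogIntegrand z.re z.im) r.domain → Literature.NumberTheory.Transcendental.KZ.Equivalent s r := by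
  intro z hz him s r hs hsi hr hri
  obtain ⟨⟨f, hf, hfi⟩, hsf⟩ := stub_fanCell z hz him s hs hsi
  obtain ⟨⟨V, hV, hVi⟩, hfV⟩ := stub_vCell z hz him f hf hfi
  obtain ⟨⟨R, hR, hRi⟩, hrR⟩ := stub_rayScale z hz him r hr hri
  obtain ⟨⟨C, hC, hCi⟩, hVRC⟩ := stub_cellAlgebra z hz him V hV hVi R hR hRi
  obtain ⟨⟨G, hG, hGi⟩, hCG⟩ := stub_cellScale z hz him C hC hCi
  have hG0 : KZ.of G ∈ KZ.relations := stub_mobiusCell z hz him G hG hGi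
  have hC0 : KZ.of C ∈ KZ.relations := by
    have h := hCG G hG hGi
    have : KZ.of C = (KZ.of C - KZ.of G) + KZ.of G := by abel
    rw [this]
    exact add_mem h hG0
  have hVR : KZ.Equivalent V R := by
    have h := hVRC C hC hCi
    have : KZ.of V - KZ.of R = (KZ.of V - KZ.of R - KZ.of C) + KZ.of C := by abel
    show KZ.of V - KZ.of R ∈ KZ.relations
    rw [this]
    exact add_mem h hC0
  exact (((hsf f hf hfi).trans (hfV V hV hVi)).trans hVR).trans (hrR R hR hRi).symm

/-- For each algebraic `z` with `Im z > 0` a flat-shadow representation exists (existence clauses of the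
stage-1 stubs, starting from `KZ.idealTetrahedronRep z`). [cite: Milnor1982, Appendix, Lemma 2] -/
theorem exists_flatRep (z : ℂ) (hz : IsAlgebraic ℚ z) (him : 0 < z.im) :
    ∃ s : KZ.IntegralRep 2,
      s.domain = {q | 0 < q 1 ∧ z.re * q 1 < z.im * q 0 ∧ z.im * (q 0 - 1) < (z.re - 1) * q 1} ∧
      EqOn s.integrand
        (fun q => z.im / (2 * (z.im * (q 0 - q 0 ^ 2 - q 1 ^ 2) + (Complex.normSq z - z.re) * q 1)))
        s.domain := by
  obtain ⟨⟨m, hm, hmi⟩, -⟩ := stub_invert _ (fun _ => rfl) z hz him (KZ.idealTetrahedronRep z hz him)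
    rfl (fun _ _ => rfl)
  exact (stub_descend _ (fun _ => rfl) _ (fun _ => rfl) _ (fun _ _ => rfl) z hz him m hm hmi).1

/-- **THE MILNOR BRIDGE.** For `z` algebraic over `ℚ` with `Im z > 0`, the ideal-tetrahedron representation
`[T(∞,0,1,z), t⁻³]` and Zagier's ray representation of `D(z)` are equivalent under Kontsevich–Zagier's rules.
[cite: Zagier2007Dilogarithm, Ch. I §3] -/
theorem milnorBridge (z : ℂ) (hz : IsAlgebraic ℚ z) (him : 0 < z.im) :
    KZ.Equivalent (KZ.idealTetrahedronRep z hz him)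
      (KZ.rayDilogRep z.re z.im (isAlgebraic_re_im hz).1 (isAlgebraic_re_im hz).2) := by
  obtain ⟨s, hs, hsi⟩ := exists_flatRep z hz him
  exact (tetraFlatten z hz him (KZ.idealTetrahedronRep z hz him) s rfl (fun _ _ => rfl) hs hsi).trans
    (rayMeetsShadow z hz him s _ hs hsi rfl (fun _ _ => rfl))

/-- Corollary, from the soundness of the calculus: `∫_{T(z)} t⁻³ = rayDilog z.re z.im` for algebraic `z` with
`Im z > 0` — Milnor's value identity by moves, independent of the tree's analytic proof.
[cite: Milnor1982, Appendix, Lemma 2] -/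
theorem value_idealTetrahedronRep_eq_rayDilog (z : ℂ) (hz : IsAlgebraic ℚ z) (him : 0 < z.im) :
    (KZ.idealTetrahedronRep z hz him).value = KZ.rayDilog z.re z.im := by
  rw [← KZ.rayDilogRep_value z.re z.im (isAlgebraic_re_im hz).1 (isAlgebraic_re_im hz).2]
  exact KZ.Equivalent.value_eq_holds (milnorBridge z hz him)

/-- An admissible flat family exists. [cite: Milnor1982, Appendix, Lemma 2] -/
theorem exists_flatFamily : ∃ σ : ℂ → KZ.IntegralRep 2, ∀ z, IsAlgebraic ℚ z → 0 < z.im →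
    (σ z).domain = {q | 0 < q 1 ∧ z.re * q 1 < z.im * q 0 ∧ z.im * (q 0 - 1) < (z.re - 1) * q 1} ∧
    EqOn (σ z).integrand
      (fun q => z.im / (2 * (z.im * (q 0 - q 0 ^ 2 - q 1 ^ 2) + (Complex.normSq z - z.re) * q 1)))
      {q | 0 < q 1 ∧ z.re * q 1 < z.im * q 0 ∧ z.im * (q 0 - 1) < (z.re - 1) * q 1} := by
  classical
  refine ⟨fun z => if h : IsAlgebraic ℚ z ∧ 0 < z.im then Classical.choose (exists_flatRep z h.1 h.2)
    else KZ.IntegralRep.empty 2, fun z hz him => ?_⟩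
  have h : IsAlgebraic ℚ z ∧ 0 < z.im := ⟨hz, him⟩
  dsimp only
  rw [dif_pos h]
  obtain ⟨hd, hi⟩ := Classical.choose_spec (exists_flatRep z h.1 h.2)
  exact ⟨hd, fun x hx => hi (by rw [hd]; exact hx)⟩

/-- An admissible ray family exists: Zagier's `KZ.rayDilogRep z.re z.im` on `ℚ̄ ∩ ℍ⁺`, the empty representation
elsewhere. [cite: Zagier2007Dilogarithm, Ch. I §3] -/
theorem exists_rayFamily : ∃ ρ : ℂ → KZ.IntegralRep 2, ∀ z, IsAlgebraic ℚ z → 0 < z.im →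
    (ρ z).domain = KZ.rayDilogDomain z.re z.im ∧
    EqOn (ρ z).integrand (KZ.rayDilogIntegrand z.re z.im) (KZ.rayDilogDomain z.re z.im) := by
  classical
  refine ⟨fun z => if h : IsAlgebraic ℚ z ∧ 0 < z.im then
    KZ.rayDilogRep z.re z.im (isAlgebraic_re_im h.1).1 (isAlgebraic_re_im h.1).2
    else KZ.IntegralRep.empty 2, fun z hz him => ?_⟩
  have h : IsAlgebraic ℚ z ∧ 0 < z.im := ⟨hz, him⟩
  dsimp only
  rw [dif_pos h]
  exact ⟨rfl, fun _ _ => rfl⟩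

end Summit.KontsevichZagierPeriods.HyperbolicBloch.OffTetraSectorKernel

end
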